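import Summits.QuantumFields.YangMills.Theorems.PoincareLipschitzDyadicMeansWeakLimitSocket
import HarnessLib

/-!
# (Γ2-lsc) Lower semicontinuity of a weak `L²` limit on a set — per-`k` `ε`-form — and bridging rows

Brick (Γ2-lsc)/(Γ2-W) letters of LINE 25 «CompactnessTransfer» (crux `PoincareLipschitz.BlockLipschitzL`,
stmt-QuantumFields-23533; crux of record `UnitScaleTilt.HistoryTailL`, stmt-QuantumFields-19936).

§1 `setIntegral_sq_le_add_of_tendsto_inner` (generic `ℒ²(μ.restrict S)`, real inner-product space):
if `∫_S ⟪G, v k⟫ → ∫_S ‖G‖²` then for every `ε > 0`, EVENTUALLY IN `k`, `∫_S ‖G‖² ≤ ∫_S ‖v k‖² + ε`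
— Cauchy–Schwarz (✓`setIntegral_inner_le_sqrt_mul_sqrt`) and `2ab ≤ a² + b²`; no `liminf`, no case
split.  This is the per-`k` form the (Γ-KNIT) `hlsc` row wants (px3 g8 2026-08-29 12:40:38Z); being
per `k`, it sums over finitely many fields exactly (px14 g6 12:44:48Z flag on the eventual-`M` form of
✓`PoincareLipschitzDyadicMeansWeakLimitSocket` does not arise).  The cube instance WITH the lattice
energy count is px5 g8's (Γ2-lsc-ε) `subcube_normSq_weakLimit_le_latticeEnergy_add` (consumer's choice,
zero twin: not restated here).
§2 Bridging rows so the knit consumes ✓`exists_weakLimit_of_dyadicMeans` (FILE B) alone: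
`tendsto_smul_pairing_of_isTestFunctionOn` (its bounded-`φ` clause (5) ⇒ the lit-`IsTestFunctionOn`
pairing row of (Γ2-IBP) ✓`hasWeakFDerivOn_of_blowDown_pairings_subseq`) and
`integrableOn_openCube_of_memLp_two` (its `MemLp` clause ⇒ `IntegrableOn G Q volume`).

HONEST: a helper (`--supports stmt-QuantumFields-19936 --as helper`); nothing of Γ2, S2♭″,
`BlockLipschitzL`, `HistoryTailL` is proved here; rung R3 = YM₃ on T³ — not d = 4, not Clay.
-/

set_option autoImplicit false

open MeasureTheory Filter Topology Set
open scoped RealInnerProductSpace ENNReal BigOperators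

namespace Summit.QuantumFields.YangMills.Theorems.PoincareLipschitzWeakLimitSubcubeLsc

open Summit.QuantumFields.YangMills.Theorems.PoincareLipschitzDyadicMeansWeakLimit (volume_openCube_lt_top)
open Summit.QuantumFields.YangMills.Theorems.PoincareLipschitzDyadicMeansWeakLimitSocket
  (setIntegral_inner_le_sqrt_mul_sqrt)

/-! ## §1 The generic per-`k` `ε`-form -/

/-- **Lower semicontinuity on a set, per-`k` `ε`-form.**  If `∫_S ⟪G, v k⟫ → ∫_S ‖G‖²` (weak
convergence tested against `G` on `S`), then for every `ε > 0`, eventually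
`∫_S ‖G‖² ≤ ∫_S ‖v k‖² + ε`.  Proof: `∫_S‖G‖² − ε/2 ≤ ∫_S⟪G, v k⟫ ≤ √(∫_S‖G‖²)·√(∫_S‖v k‖²)
≤ (∫_S‖G‖² + ∫_S‖v k‖²)/2`. [folklore] -/
theorem setIntegral_sq_le_add_of_tendsto_inner {X : Type*} [MeasurableSpace X] {μ : Measure X}
    {F : Type*} [NormedAddCommGroup F] [InnerProductSpace ℝ F]
    {S : Set X} {G : X → F} {v : ℕ → X → F} (hG : MemLp G 2 (μ.restrict S))
    (hv : ∀ k, MemLp (v k) 2 (μ.restrict S))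
    (hlim : Tendsto (fun k => ∫ x in S, ⟪G x, v k x⟫ ∂μ) atTop (𝓝 (∫ x in S, ‖G x‖ ^ 2 ∂μ)))
    {ε : ℝ} (hε : 0 < ε) :
    ∀ᶠ k in atTop, ∫ x in S, ‖G x‖ ^ 2 ∂μ ≤ ∫ x in S, ‖v k x‖ ^ 2 ∂μ + ε := by
  have hg0 : 0 ≤ ∫ x in S, ‖G x‖ ^ 2 ∂μ := integral_nonneg fun x => sq_nonneg _
  have hev : ∀ᶠ k in atTop, ∫ x in S, ‖G x‖ ^ 2 ∂μ - ε / 2 < ∫ x in S, ⟪G x, v k x⟫ ∂μ :=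
    hlim.eventually (lt_mem_nhds (by linarith))
  filter_upwards [hev] with k hk
  have hv0 : 0 ≤ ∫ x in S, ‖v k x‖ ^ 2 ∂μ := integral_nonneg fun x => sq_nonneg _
  have hcs := setIntegral_inner_le_sqrt_mul_sqrt hG (hv k)
  -- `√a · √b ≤ (a + b)/2`
  have hamgm : Real.sqrt (∫ x in S, ‖G x‖ ^ 2 ∂μ) * Real.sqrt (∫ x in S, ‖v k x‖ ^ 2 ∂μ) ≤
      ((∫ x in S, ‖G x‖ ^ 2 ∂μ) + ∫ x in S, ‖v k x‖ ^ 2 ∂μ) / 2 := by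
    have h := two_mul_le_add_sq (Real.sqrt (∫ x in S, ‖G x‖ ^ 2 ∂μ))
      (Real.sqrt (∫ x in S, ‖v k x‖ ^ 2 ∂μ))
    rw [Real.sq_sqrt hg0, Real.sq_sqrt hv0] at h
    linarith
  linarith

/-! ## §2 Bridging rows for the knit (from (Γ2-W) FILE B's clauses to the (Γ2-IBP) hypotheses) -/

/-- From the bounded-`φ` pairing clause of ✓`exists_weakLimit_of_dyadicMeans` (clause (5)) to the
test-function pairing row the (Γ2-IBP) pen consumes: a test function on `Q` (lit `IsTestFunctionOn`)
is continuous with compact support, hence bounded and a.e.-strongly measurable. [folklore] -/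
theorem tendsto_smul_pairing_of_isTestFunctionOn
    {v : ℕ → EuclideanSpace ℝ (Fin 3) → EuclideanSpace ℝ (Fin 4)}
    {G : EuclideanSpace ℝ (Fin 3) → EuclideanSpace ℝ (Fin 4)}
    (h5 : ∀ (φ : EuclideanSpace ℝ (Fin 3) → ℝ) (B : ℝ),
      AEStronglyMeasurable φ (volume.restrict {x : EuclideanSpace ℝ (Fin 3) | ∀ i : Fin 3, |x i| < 1}) →
      (∀ x, |φ x| ≤ B) →
      Tendsto (fun k : ℕ => ∫ x in {x : EuclideanSpace ℝ (Fin 3) | ∀ i : Fin 3, |x i| < 1}, φ x • v k x)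
        atTop (𝓝 (∫ x in {x : EuclideanSpace ℝ (Fin 3) | ∀ i : Fin 3, |x i| < 1}, φ x • G x)))
    (hQ : IsOpen {x : EuclideanSpace ℝ (Fin 3) | ∀ i : Fin 3, |x i| < 1})
    (φ : EuclideanSpace ℝ (Fin 3) → ℝ)
    (hφ : Literature.Analysis.FunctionSpaces.IsTestFunctionOn
      ⟨{x : EuclideanSpace ℝ (Fin 3) | ∀ i : Fin 3, |x i| < 1}, hQ⟩ φ) :
    Tendsto (fun k : ℕ => ∫ x in {x : EuclideanSpace ℝ (Fin 3) | ∀ i : Fin 3, |x i| < 1}, φ x • v k x)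
      atTop (𝓝 (∫ x in {x : EuclideanSpace ℝ (Fin 3) | ∀ i : Fin 3, |x i| < 1}, φ x • G x)) := by
  have hcont : Continuous φ := hφ.contDiff.continuous
  obtain ⟨B, hB⟩ := hcont.bounded_above_of_compact_support hφ.hasCompactSupport
  exact h5 φ B hcont.aestronglyMeasurable (fun x => by
    have := hB x; rwa [Real.norm_eq_abs] at this)

/-- `ℒ²(Q)` functions are integrable on `Q` (finite volume): the `IntegrableOn G Q volume` row of the
(Γ2-IBP) hypotheses from the `MemLp G 2 (volume.restrict Q)` clause of (Γ2-W). [folklore] -/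
theorem integrableOn_openCube_of_memLp_two {F : Type*} [NormedAddCommGroup F]
    {G : EuclideanSpace ℝ (Fin 3) → F}
    (hG : MemLp G 2 (volume.restrict {x : EuclideanSpace ℝ (Fin 3) | ∀ i : Fin 3, |x i| < 1})) :
    IntegrableOn G {x : EuclideanSpace ℝ (Fin 3) | ∀ i : Fin 3, |x i| < 1} volume := by
  haveI : IsFiniteMeasure (volume.restrict {x : EuclideanSpace ℝ (Fin 3) | ∀ i : Fin 3, |x i| < 1}) :=
    isFiniteMeasure_restrict.2 volume_openCube_lt_top.ne
  exact hG.integrable one_le_two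

end Summit.QuantumFields.YangMills.Theorems.PoincareLipschitzWeakLimitSubcubeLsc
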